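import Summits.RiemannHypothesis.RiemannHypothesis.Theses.WeilGroundState
import Summits.RiemannHypothesis.RiemannHypothesis.Theorems.WeilGroundStateGroundStatesConvergeToXiStubMomentsOfStrip
import Summits.RiemannHypothesis.RiemannHypothesis.Theorems.WeilGroundStateGroundStatesConvergeToXiStubPointwiseOfTightMoments
import Summits.RiemannHypothesis.RiemannHypothesis.Theorems.WeilGroundStateGroundStatesConvergeToXiStubLocallyUniformOfPointwise
import Summits.RiemannHypothesis.RiemannHypothesis.Theorems.WeilGroundStateGroundStatesConvergeToXiLineExact
import Summits.RiemannHypothesis.RiemannHypothesis.Theorems.WeilGroundStateGroundStatesConvergeToXiRenormBlowup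
import Literature.NumberTheory.LFunctions.RiemannXiHadamardProduct
import HarnessLib

/-!
# `WeilGroundState.GroundStatesConvergeToXi` — line exactness in MOMENT form and the moment
observables of a crux witness (crux item stmt-RiemannHypothesis-1527, route
route-RiemannHypothesis-WeilGroundState; line `Sketch`, skeleton rev L7, lead c5; `--supports`)

The rev L7 skeleton replaces the weak-convergence clause (W) of the open stub C⁺ by the MOMENT
clause (M) `∀ n, c_k ∫ u_k tⁿ → ∫ Φ tⁿ` (`Φ = 2Ψ(2·)`, `∫ Φ tⁿ = ξ⁽ⁿ⁾(1/2)`).  With the two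
RH-free stubs of wave 1 LANDED (`stub_pointwise_of_tight_moments` p145555,
`stub_moments_of_strip` p145888) this file records, sorry-free:

* `tendstoLocallyUniformlyOn_of_tight_of_moments` — transfer (T) ∧ (M) ⇒ the crux's convergence
  clause; `groundStatesConvergeToXi_of_tightMomentLimit` — the crux from a (T) ∧ (M) witness.
* **Exactness**: `tightMomentLimit_iff_tight_cruxWitness` ((T) ∧ (M) ⟺ (T) ∧ crux-witness),
  `tightMomentLimit_iff_tightWeakLimit` (⟺ the old C⁺), hence `riemannHypothesis_of_tightMomentLimit`
  (the new open stub is ≥ RH, like C⁺).  Every clause of the open stub except tightness (T) is now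
  a PROVED consequence of the crux.
* **Moment observables of the crux (RH-free necessary conditions)**: along every witness of the
  convergence clause ALL normalised moments converge, `∫u_k tⁿ/∫u_k → ∫Φtⁿ/∫Φ`
  (`tendsto_moment_div_integral`); in particular the WIDTH LAW of the crux numerics,
  `W(u_k) = ∫t²u_k/∫u_k → ξ″(1/2)/ξ(1/2) = W_Φ` (r1-k2: `W(u_a) = 0.0220, 0.0296, 0.0367,
  0.0406, 0.0428 ↑ W_Φ = 0.0462`), is a theorem-level consequence of the crux.
* **Moment criterion**: a crux witness with ONE moment (any order `n`) bounded away from zero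
  infinitely often, `‖∫ u_k tⁿ‖ ≥ m > 0`, proves RH
  (`riemannHypothesis_of_cruxWitness_frequently_norm_moment_ge`); under `¬RH` all moments of the
  normalised ground states of a witness tend to `0`.  (Every even moment of `Φ` is a positive
  real, `integral_phi_mul_pow_even_ne_zero`.)
No new definitions.
-/

noncomputable section

set_option linter.dupNamespace false

open scoped Topology Real ComplexConjugate
open Filter Set MeasureTheory Complex

namespace Summit.RiemannHypothesis.RiemannHypothesis.Theorems.GroundStatesConvergeToXi

open Literature.NumberTheory.LFunctions

/-! ## Transfer by moments and the crux from a `(T) ∧ (M)` witness -/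

/-- **Transfer, moment route (RH-free): (T) ∧ (M) ⇒ the crux's convergence clause.**  Pointwise
convergence on `(0,1)` (`stub_pointwise_of_tight_moments`), then Vitali
(`stub_locallyUniform_of_pointwise`). [folklore] -/
theorem tendstoLocallyUniformlyOn_of_tight_of_moments
    {a : ℕ → ℝ} {u : ℕ → ℝ → ℂ} {c : ℕ → ℂ}
    (hu : ∀ k, IsWeilGroundState (a k) (u k))
    (htight : ∀ b : ℝ, b < 1 / 2 → ∃ M : ℝ, ∀ k, ∫ t, ‖c k * u k t‖ * Real.exp (b * |t|) ≤ M)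
    (hmom : ∀ n : ℕ, Tendsto (fun k => c k * ∫ t, u k t * (t : ℂ) ^ n) atTop
      (𝓝 (∫ t, 2 * LagariasMontague.Psic (2 * t) * (t : ℂ) ^ n))) :
    TendstoLocallyUniformlyOn (fun k s => c k * weilMellin (u k) s) riemannXi atTop
      {s : ℂ | 0 < s.re ∧ s.re < 1} :=
  stub_locallyUniform_of_pointwise hu htight (stub_pointwise_of_tight_moments hu htight hmom)

/-- **The crux from a `(T) ∧ (M)` witness** (composition of the rev L7 skeleton with its open stub
as hypothesis). [folklore] -/
theorem groundStatesConvergeToXi_of_tightMomentLimit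
    (h : ∃ a : ℕ → ℝ, ∃ u : ℕ → ℝ → ℂ, ∃ c : ℕ → ℂ, Tendsto a atTop atTop ∧ (∀ k, c k ≠ 0) ∧
      (∀ k, IsWeilGroundState (a k) (u k)) ∧
      (∀ b : ℝ, b < 1 / 2 → ∃ M : ℝ, ∀ k, ∫ t, ‖c k * u k t‖ * Real.exp (b * |t|) ≤ M) ∧
      (∀ n : ℕ, Tendsto (fun k => c k * ∫ t, u k t * (t : ℂ) ^ n) atTop
        (𝓝 (∫ t, 2 * LagariasMontague.Psic (2 * t) * (t : ℂ) ^ n)))) :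
    Summit.RiemannHypothesis.RiemannHypothesis.Theses.WeilGroundState.GroundStatesConvergeToXi := by
  obtain ⟨a, u, c, ha, hc, hu, htight, hmom⟩ := h
  exact ⟨a, u, c, ha, fun k => ⟨(hu k).pos, hc k, (hu k).1, (hu k).2⟩,
    tendstoLocallyUniformlyOn_of_tight_of_moments hu htight hmom⟩

/-! ## Exactness of the reshaped line -/

/-- **Line exactness, moment form (RH-free): `(T) ∧ (M)`-witnesses are EXACTLY the `(T)`-tight
witnesses of the crux.**  (⇒) transfer by moments; (⇐) `stub_moments_of_strip`. [folklore] -/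
theorem tightMomentLimit_iff_tight_cruxWitness :
    (∃ a : ℕ → ℝ, ∃ u : ℕ → ℝ → ℂ, ∃ c : ℕ → ℂ, Tendsto a atTop atTop ∧ (∀ k, c k ≠ 0) ∧
      (∀ k, IsWeilGroundState (a k) (u k)) ∧
      (∀ b : ℝ, b < 1 / 2 → ∃ M : ℝ, ∀ k, ∫ t, ‖c k * u k t‖ * Real.exp (b * |t|) ≤ M) ∧
      (∀ n : ℕ, Tendsto (fun k => c k * ∫ t, u k t * (t : ℂ) ^ n) atTop
        (𝓝 (∫ t, 2 * LagariasMontague.Psic (2 * t) * (t : ℂ) ^ n)))) ↔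
    (∃ a : ℕ → ℝ, ∃ u : ℕ → ℝ → ℂ, ∃ c : ℕ → ℂ, Tendsto a atTop atTop ∧ (∀ k, c k ≠ 0) ∧
      (∀ k, IsWeilGroundState (a k) (u k)) ∧
      (∀ b : ℝ, b < 1 / 2 → ∃ M : ℝ, ∀ k, ∫ t, ‖c k * u k t‖ * Real.exp (b * |t|) ≤ M) ∧
      TendstoLocallyUniformlyOn (fun k s => c k * weilMellin (u k) s) riemannXi atTop
        {s : ℂ | 0 < s.re ∧ s.re < 1}) := by
  constructor
  · rintro ⟨a, u, c, ha, hc, hu, htight, hmom⟩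
    exact ⟨a, u, c, ha, hc, hu, htight, tendstoLocallyUniformlyOn_of_tight_of_moments hu htight hmom⟩
  · rintro ⟨a, u, c, ha, hc, hu, htight, hlim⟩
    exact ⟨a, u, c, ha, hc, hu, htight, stub_moments_of_strip hu hlim⟩

/-- **The new open stub is equivalent to the old one**: `(T) ∧ (M)` ⟺ C⁺ `= (T) ∧ (W)`
(both are ⟺ "(T)-tight crux witness": `tightWeakLimit_iff_tight_cruxWitness`, `…LineExact`). [folklore] -/
theorem tightMomentLimit_iff_tightWeakLimit :
    (∃ a : ℕ → ℝ, ∃ u : ℕ → ℝ → ℂ, ∃ c : ℕ → ℂ, Tendsto a atTop atTop ∧ (∀ k, c k ≠ 0) ∧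
      (∀ k, IsWeilGroundState (a k) (u k)) ∧
      (∀ b : ℝ, b < 1 / 2 → ∃ M : ℝ, ∀ k, ∫ t, ‖c k * u k t‖ * Real.exp (b * |t|) ≤ M) ∧
      (∀ n : ℕ, Tendsto (fun k => c k * ∫ t, u k t * (t : ℂ) ^ n) atTop
        (𝓝 (∫ t, 2 * LagariasMontague.Psic (2 * t) * (t : ℂ) ^ n)))) ↔
    (∃ a : ℕ → ℝ, ∃ u : ℕ → ℝ → ℂ, ∃ c : ℕ → ℂ, Tendsto a atTop atTop ∧ (∀ k, c k ≠ 0) ∧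
      (∀ k, IsWeilGroundState (a k) (u k)) ∧
      (∀ b : ℝ, b < 1 / 2 → ∃ M : ℝ, ∀ k, ∫ t, ‖c k * u k t‖ * Real.exp (b * |t|) ≤ M) ∧
      (∀ g : ℝ → ℂ, IsWeilTest g →
        Tendsto (fun k => ∫ t, c k * u k t * g t) atTop
          (𝓝 (∫ t, 2 * LagariasMontague.Psic (2 * t) * g t)))) :=
  tightMomentLimit_iff_tight_cruxWitness.trans tightWeakLimit_iff_tight_cruxWitness.symm

/-- **The new open stub is ≥ RH** (through the equivalence with C⁺ and
`riemannHypothesis_of_tightWeakLimit`, p136942). [folklore] -/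
theorem riemannHypothesis_of_tightMomentLimit
    (h : ∃ a : ℕ → ℝ, ∃ u : ℕ → ℝ → ℂ, ∃ c : ℕ → ℂ, Tendsto a atTop atTop ∧ (∀ k, c k ≠ 0) ∧
      (∀ k, IsWeilGroundState (a k) (u k)) ∧
      (∀ b : ℝ, b < 1 / 2 → ∃ M : ℝ, ∀ k, ∫ t, ‖c k * u k t‖ * Real.exp (b * |t|) ≤ M) ∧
      (∀ n : ℕ, Tendsto (fun k => c k * ∫ t, u k t * (t : ℂ) ^ n) atTop
        (𝓝 (∫ t, 2 * LagariasMontague.Psic (2 * t) * (t : ℂ) ^ n)))) :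
    RiemannHypothesis :=
  riemannHypothesis_of_tightWeakLimit (tightMomentLimit_iff_tightWeakLimit.1 h)

/-! ## The moments of Riemann's kernel -/

/-- `Φ(t) = 2Ψ(2t) > 0` for every real `t` (`Ψ > 0` on `[0,∞)` and `Ψ` is even). [folklore] -/
theorem phi_re_pos (t : ℝ) : 0 < 2 * LagariasMontague.Psi (2 * t) := by
  rcases le_or_gt 0 t with ht | ht
  · exact mul_pos two_pos (Negative.Psi_pos_of_nonneg (by positivity))
  · rw [← LagariasMontague.Psi_neg]
    exact mul_pos two_pos (Negative.Psi_pos_of_nonneg (by linarith))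

/-- The `n`-th moment of `Φ` as a real integral: `∫ Φ tⁿ = ↑(∫ 2Ψ(2t) tⁿ dt)`. [folklore] -/
theorem integral_phi_mul_pow_eq_ofReal (n : ℕ) :
    (∫ t : ℝ, (2 : ℂ) * LagariasMontague.Psic (2 * t) * (t : ℂ) ^ n) =
      ((∫ t : ℝ, 2 * LagariasMontague.Psi (2 * t) * t ^ n : ℝ) : ℂ) := by
  rw [← integral_complex_ofReal]
  refine integral_congr_ae (ae_of_all _ fun t => ?_)
  simp only [LagariasMontague.Psic]
  push_cast
  ring

/-- `Φ(t) tⁿ` is integrable (all exponential moments of `Φ` are finite and `|t|ⁿ ≤ n! e^{|t|}`).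
[folklore] -/
theorem integrable_phi_mul_pow (n : ℕ) :
    Integrable fun t : ℝ => (2 : ℂ) * LagariasMontague.Psic (2 * t) * (t : ℂ) ^ n := by
  have h := momentsOfStrip_expMoment_phi 1
  refine ((h.const_mul (n.factorial : ℝ))).mono' ((continuous_phi.mul (by fun_prop)).aestronglyMeasurable)
    (ae_of_all _ fun t => ?_)
  rw [norm_mul, norm_pow, Complex.norm_real, Real.norm_eq_abs]
  have h1 : |t| ^ n / (n.factorial : ℝ) ≤ Real.exp |t| :=
    Real.pow_div_factorial_le_exp (|t|) (abs_nonneg t) n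
  have hn : (0 : ℝ) < n.factorial := by exact_mod_cast Nat.factorial_pos n
  rw [div_le_iff₀ hn] at h1
  have h2 : 0 ≤ ‖(2 : ℂ) * LagariasMontague.Psic (2 * t)‖ := norm_nonneg _
  calc ‖(2 : ℂ) * LagariasMontague.Psic (2 * t)‖ * |t| ^ n
      ≤ ‖(2 : ℂ) * LagariasMontague.Psic (2 * t)‖ * (Real.exp |t| * n.factorial) :=
        mul_le_mul_of_nonneg_left h1 h2
    _ = (n.factorial : ℝ) * (‖(2 : ℂ) * LagariasMontague.Psic (2 * t)‖ * Real.exp (1 * |t|)) := by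
        rw [one_mul]; ring

/-- The real moments `∫ 2Ψ(2t) tⁿ` are integrable integrands. [folklore] -/
theorem integrable_phi_re_mul_pow (n : ℕ) :
    Integrable fun t : ℝ => 2 * LagariasMontague.Psi (2 * t) * t ^ n := by
  have h := (integrable_phi_mul_pow n).re
  refine h.congr (ae_of_all _ fun t => ?_)
  simp only [LagariasMontague.Psic]
  norm_cast

/-- **Every EVEN moment of Riemann's kernel is positive**: `0 < ∫ 2Ψ(2t) t^{2m} dt`. [folklore] -/
theorem integral_phi_re_mul_pow_even_pos (m : ℕ) :
    0 < ∫ t : ℝ, 2 * LagariasMontague.Psi (2 * t) * t ^ (2 * m) := by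
  have hnn : ∀ t : ℝ, 0 ≤ 2 * LagariasMontague.Psi (2 * t) * t ^ (2 * m) := fun t =>
    mul_nonneg (phi_re_pos t).le (by rw [pow_mul]; positivity)
  rw [integral_pos_iff_support_of_nonneg hnn (integrable_phi_re_mul_pow (2 * m))]
  have hsub : Ioi (0 : ℝ) ⊆ Function.support fun t : ℝ => 2 * LagariasMontague.Psi (2 * t) * t ^ (2 * m) := by
    intro t ht
    rw [Function.mem_support]
    exact (mul_pos (phi_re_pos t) (pow_pos ht _)).ne'
  exact lt_of_lt_of_le (by simp) (measure_mono hsub)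

/-- **Every even moment of `Φ` is a non-zero (positive real) number**: `∫ Φ t^{2m} ≠ 0`; in
particular `∫ Φ = ξ(1/2) ≠ 0` (`m = 0`) and `∫ Φ t² = ξ″(1/2) ≠ 0` (`m = 1`). [folklore] -/
theorem integral_phi_mul_pow_even_ne_zero (m : ℕ) :
    (∫ t : ℝ, (2 : ℂ) * LagariasMontague.Psic (2 * t) * (t : ℂ) ^ (2 * m)) ≠ 0 := by
  rw [integral_phi_mul_pow_eq_ofReal, Ne, Complex.ofReal_eq_zero]
  exact (integral_phi_re_mul_pow_even_pos m).ne'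

/-! ## The moment observables of a witness -/

/-- **All normalised moments of a witness converge (RH-free necessary condition of the crux).**
If `u_k` are ground states and `c_k û_k → ξ` locally uniformly on the open strip, then for every
`n`, `∫ u_k tⁿ / ∫ u_k → ∫ Φ tⁿ / ∫ Φ = ξ⁽ⁿ⁾(1/2)/ξ(1/2)` (the renormalisation drops out; the
denominators are eventually non-zero since `c_k ∫ u_k → ξ(1/2) ≠ 0`).  For `n = 2` this is the
WIDTH LAW `W(u_k) → W_Φ = ξ″(1/2)/ξ(1/2)` observed in the crux numerics. [folklore] -/
theorem tendsto_moment_div_integral {a : ℕ → ℝ} {u : ℕ → ℝ → ℂ} {c : ℕ → ℂ}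
    (hu : ∀ k, IsWeilGroundState (a k) (u k))
    (hlim : TendstoLocallyUniformlyOn (fun k s => c k * weilMellin (u k) s) riemannXi atTop
      {s : ℂ | 0 < s.re ∧ s.re < 1}) (n : ℕ) :
    Tendsto (fun k => (∫ t, u k t * (t : ℂ) ^ n) / ∫ t, u k t) atTop
      (𝓝 ((∫ t, 2 * LagariasMontague.Psic (2 * t) * (t : ℂ) ^ n) /
        ∫ t, 2 * LagariasMontague.Psic (2 * t))) := by
  have hn := stub_moments_of_strip hu hlim n
  have h0 := stub_moments_of_strip hu hlim 0
  simp only [pow_zero, mul_one] at h0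
  have hne : (∫ t : ℝ, (2 : ℂ) * LagariasMontague.Psic (2 * t)) ≠ 0 := by
    have := integral_phi_mul_pow_even_ne_zero 0
    simpa using this
  have hq := hn.div h0 hne
  refine hq.congr' ?_
  filter_upwards [h0.eventually_ne hne] with k hk
  have hck : c k ≠ 0 := left_ne_zero_of_mul hk
  show (c k * ∫ t, u k t * (t : ℂ) ^ n) / (c k * ∫ t, u k t) = (∫ t, u k t * (t : ℂ) ^ n) / ∫ t, u k t
  rw [mul_div_mul_left _ _ hck]

/-- **Moment criterion (RH-free mechanism): a crux witness with ONE moment bounded away from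
zero infinitely often proves RH.**  If `‖∫ u_k tⁿ‖ ≥ m > 0` frequently for some `n` (any `n`,
whether or not `∫ Φ tⁿ` vanishes), then `‖c_k‖ ≤ (‖∫Φtⁿ‖ + 1)/m` along those `k`
(`c_k ∫u_k tⁿ → ∫Φtⁿ`, `stub_moments_of_strip`), and bounded renormalisation constants along a
subsequence prove RH (`riemannHypothesis_of_cruxWitness_norm_le`). [folklore] -/
theorem riemannHypothesis_of_cruxWitness_frequently_norm_moment_ge {a : ℕ → ℝ} {u : ℕ → ℝ → ℂ}
    {c : ℕ → ℂ} (ha : Tendsto a atTop atTop) (hu : ∀ k, IsWeilGroundState (a k) (u k))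
    (hlim : TendstoLocallyUniformlyOn (fun k s => c k * weilMellin (u k) s) riemannXi atTop
      {s : ℂ | 0 < s.re ∧ s.re < 1}) {n : ℕ}
    (hm : ∃ m : ℝ, 0 < m ∧ ∃ᶠ k in atTop, m ≤ ‖∫ t, u k t * (t : ℂ) ^ n‖) : RiemannHypothesis := by
  obtain ⟨m, hm0, hmf⟩ := hm
  set μ : ℂ := ∫ t : ℝ, (2 : ℂ) * LagariasMontague.Psic (2 * t) * (t : ℂ) ^ n with hμdef
  have hconv := (stub_moments_of_strip hu hlim n).norm
  have hev : ∀ᶠ k in atTop, ‖c k * ∫ t, u k t * (t : ℂ) ^ n‖ ≤ ‖μ‖ + 1 := by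
    filter_upwards [hconv.eventually (Iio_mem_nhds (show ‖μ‖ < ‖μ‖ + 1 by linarith))] with k hk
    exact hk.le
  refine riemannHypothesis_of_cruxWitness_norm_le ha hu hlim ⟨(‖μ‖ + 1) / m, ?_⟩
  refine (hmf.and_eventually hev).mono fun k hk => ?_
  obtain ⟨hmk, hk⟩ := hk
  rw [norm_mul] at hk
  rw [le_div_iff₀ hm0]
  calc ‖c k‖ * m ≤ ‖c k‖ * ‖∫ t, u k t * (t : ℂ) ^ n‖ := mul_le_mul_of_nonneg_left hmk (norm_nonneg _)
    _ ≤ ‖μ‖ + 1 := hk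

/-- **Under `¬RH`, all moments of the normalised ground states of a crux witness tend to zero**
(`‖c_k‖ → ∞` while `c_k ∫ u_k tⁿ` converges). [folklore] -/
theorem tendsto_moment_zero_of_not_riemannHypothesis (hRH : ¬ RiemannHypothesis)
    {a : ℕ → ℝ} {u : ℕ → ℝ → ℂ} {c : ℕ → ℂ}
    (ha : Tendsto a atTop atTop) (hu : ∀ k, IsWeilGroundState (a k) (u k))
    (hlim : TendstoLocallyUniformlyOn (fun k s => c k * weilMellin (u k) s) riemannXi atTop
      {s : ℂ | 0 < s.re ∧ s.re < 1}) (n : ℕ) :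
    Tendsto (fun k => ∫ t, u k t * (t : ℂ) ^ n) atTop (𝓝 0) := by
  have hc := tendsto_norm_atTop_of_not_riemannHypothesis hRH ha hu hlim
  have hconv := (stub_moments_of_strip hu hlim n).norm
  set μ : ℂ := ∫ t : ℝ, (2 : ℂ) * LagariasMontague.Psic (2 * t) * (t : ℂ) ^ n with hμdef
  have hbd : ∀ᶠ k in atTop, ‖c k * ∫ t, u k t * (t : ℂ) ^ n‖ ≤ ‖μ‖ + 1 := by
    filter_upwards [hconv.eventually (Iio_mem_nhds (show ‖μ‖ < ‖μ‖ + 1 by linarith))] with k hk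
    exact hk.le
  rw [tendsto_zero_iff_norm_tendsto_zero]
  have hinv : Tendsto (fun k => (‖μ‖ + 1) * ‖c k‖⁻¹) atTop (𝓝 0) := by
    simpa using (tendsto_inv_atTop_zero.comp hc).const_mul (‖μ‖ + 1)
  refine tendsto_of_tendsto_of_tendsto_of_le_of_le' tendsto_const_nhds hinv
    (Eventually.of_forall fun k => norm_nonneg _) ?_
  filter_upwards [hbd, hc.eventually (eventually_gt_atTop 0)] with k hk hck
  rw [norm_mul] at hk
  rw [← div_eq_mul_inv, le_div_iff₀ hck, mul_comm]
  exact hk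

end Summit.RiemannHypothesis.RiemannHypothesis.Theorems.GroundStatesConvergeToXi

end
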